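import Literature.NumberTheory.Automorphic.UnitaryGroupTruncationFiniteSum
import Literature.NumberTheory.Automorphic.AdelicVectorHeightPairing
import HarnessLib

/-!
# The height drop off the Borel: `H(γ g) · H(g) ≤ 1` for `γ ∈ U(J_N)(F)` in the big Bruhat cell — the `U(J_N)` analogue of
# `Im(γz) · Im(z) ≤ 1` (rank-one reduction theory for the truncated trace formula)
(Rogawski, *Automorphic Representations of Unitary Groups in Three Variables* (1990), §2.2 p. 13; Garrett, *Modern Analysis of Automorphic
Forms by Example* (2018), §1.5 / §2.2–§2.3 (reduction theory via heights); Godement, *Domaines fondamentaux des groupes arithmétiques*,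
Sém. Bourbaki 257 (1962/63), §1.1)

Topic `NumberTheory/Automorphic`; namespaces `Literature.NumberTheory.Automorphic` (§1, heights of reindexed vectors) and
`Literature.NumberTheory.Automorphic.UnitaryGroup` (§§2–4). THEOREMS ONLY over accepted tree modules (no definition, no named fact, no
instance, no `sorry`). A kernel brick of sub-line T1-qs of the floor-0 ENGINE T1 (F0P3a; LEAD ruling #87 (b), second hand next to
F0P3a-p05's trunk towards the discharge of ★ `UnitaryGroup.TruncatedKernelIntegrable`).

THE INEQUALITY. Let `G = U(J_N)` (★ `UnitaryGroup.quasiSplit F E c N`), `H = borelHeight` (★ `UnitaryGroupBorelHeight`: `H(g) = h(e_N g)⁻¹`,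
`h` the Godement–Garrett height of adelic row vectors, ★ `AdelicVectorHeight`). For a RATIONAL `γ ∈ G(F)` whose bottom-left entry `γ_{N,1}` is
non-zero (the big Bruhat cell; for `N = 3` this is exactly `γ ∉ B(F)`, §4) and ANY `g ∈ G(𝔸_F)`:

  **`H(γ g) · H(g) ≤ 1`** (`borelHeight_toAdelic_mul_mul_borelHeight_le_one`).

PROOF (no Siegel set, no Iwasawa decomposition). Let `y` be the FIRST COLUMN of `g⁻¹`; for the antidiagonal form, `(g⁻¹)_{k,1} = c(g_{N, rev k})`
(★ `coe_inv_apply_of_mem_unitaryGroupOfForm_antidiagonal`), so `y = c • (e_N g ∘ rev)` and `h(y) = h(e_N g)` (Galois invariance ★ `vecHeight_galSmul`,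
reindexing §1). The scalar product `(e_N γ g) · y = (γ g g⁻¹)_{N,1} = γ_{N,1}` is a PRINCIPAL idèle, so Godement's fundamental inequality
★ `ideleNorm_le_vecHeight_mul_vecHeight` and the product formula ★ `ideleNorm_principal` give `1 = |γ_{N,1}|_𝔸 ≤ h(e_N γ g) · h(e_N g)`, i.e.
`H(γ g) · H(g) ≤ 1`. For `SL₂(ℤ)` this is `y(γz) y(z) = y² ∕ |cz + d|² · … ≤ c⁻² ≤ 1`.

* §1 `vecFinHeight_comp_equiv`, `vecArchNorm_comp_equiv`, `isHeightFinite_comp_equiv_iff`, `vecHeight_comp_equiv` — heights are invariant under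
  reindexing the coordinates.
* §2 the first column of `g⁻¹`: `coe_inv_apply_zero_eq_smul_lastRow_rev`, `vecHeight_inv_col_zero`, `isHeightFinite_inv_col_zero`; the pairing
  `lastRow_dotProduct_inv_col`, `lastRow_toAdelic_mul_dotProduct_inv_col_zero` (`= γ_{N,1}`).
* §3 **`one_le_vecHeight_lastRow_mul`**, **`borelHeight_toAdelic_mul_mul_borelHeight_le_one`**, `borelHeight_toAdelic_mul_le_inv` (every `N ≥ 1`).
* §4 (`N = 3`) `apply_top_zero_ne_zero_of_not_mem_borelAdelic` — the last row of `γ ∈ U(J₃)(F)` is ISOTROPIC, so `γ_{3,1} = 0` forces `γ_{3,2} = 0`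
  and `γ ∈ B` (★ `mem_borelAdelic_toAdelic_of_lastRow_eq_smul`); hence **`borelHeight_mul_borelHeight_le_one_of_not_mem_borelAdelic`** and the
  `arithmeticSubgroup` ∕ ★ `arithmeticBorel` reading **`borelHeight_mul_borelHeight_le_one_of_not_mem_arithmeticBorel`**: for every
  `γ ∈ G(F) ∖ B(F)` and every `g`, `H(γ g) · H(g) ≤ 1` — so `g` and `γ g` are never simultaneously high in the cusp (the first step of
  «`k^T(x) = K(x,x) − K_B(x,x)` on the Siegel set for `T` large», Rogawski §2.2; Arthur 1978 §§6–7).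

## References

* J. D. Rogawski, *Automorphic Representations of Unitary Groups in Three Variables*, Ann. of Math. Stud. 123 (1990), §2.2 p. 13 [Rogawski1990].
* P. Garrett, *Modern Analysis of Automorphic Forms by Example* (2018), §1.5, §2.2–§2.3 [Garrett2018].
* R. Godement, *Domaines fondamentaux des groupes arithmétiques*, Sém. Bourbaki 257 (1962/63), §1.1 [Godement1964].
-/

noncomputable section

open NumberField IsDedekindDomain Matrix
open scoped NNReal MatrixGroups

namespace Literature.NumberTheory.Automorphic

/-! ## §1 Heights of reindexed vectors -/

section Reindex

variable (K : Type) [Field K] [NumberField K] {ι κ : Type*} [Fintype ι] [Fintype κ]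

/-- Finite local heights are invariant under reindexing the coordinates. [cite: Garrett2018, §2.2 (PDF p. 81)] -/
theorem vecFinHeight_comp_equiv (e : κ ≃ ι) (v : HeightOneSpectrum (𝓞 K)) (x : ι → AdeleRing (𝓞 K) K) :
    vecFinHeight K v (x ∘ e) = vecFinHeight K v x := by
  unfold vecFinHeight
  refine le_antisymm (Finset.sup_le fun k _ => ?_) (Finset.sup_le fun i _ => ?_)
  · exact Finset.le_sup (f := fun i => ‖(x i).2 v‖₊) (Finset.mem_univ (e k))
  · have h : ‖(x i).2 v‖₊ = ‖((x ∘ e) (e.symm i)).2 v‖₊ := by rw [Function.comp_apply, e.apply_symm_apply]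
    rw [h]
    exact Finset.le_sup (f := fun k => ‖((x ∘ e) k).2 v‖₊) (Finset.mem_univ (e.symm i))

/-- Archimedean local norms are invariant under reindexing the coordinates. [cite: Garrett2018, §2.2 (PDF p. 81)] -/
theorem vecArchNorm_comp_equiv (e : κ ≃ ι) (w : InfinitePlace K) (x : ι → AdeleRing (𝓞 K) K) :
    vecArchNorm K w (x ∘ e) = vecArchNorm K w x := by
  unfold vecArchNorm
  congr 1
  exact Fintype.sum_equiv e (fun i => ‖((x ∘ e) i).1 w‖₊ ^ 2) (fun i => ‖(x i).1 w‖₊ ^ 2) fun _ => rfl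

/-- Height-finiteness is invariant under reindexing the coordinates. [cite: Garrett2018, §2.2 (PDF p. 82)] -/
theorem isHeightFinite_comp_equiv_iff (e : κ ≃ ι) (x : ι → AdeleRing (𝓞 K) K) :
    IsHeightFinite K (x ∘ e) ↔ IsHeightFinite K x := by
  unfold IsHeightFinite
  simp_rw [vecFinHeight_comp_equiv K e]

/-- **The height is invariant under reindexing the coordinates.** [cite: Garrett2018, §2.2 (PDF p. 81)] -/
theorem vecHeight_comp_equiv (e : κ ≃ ι) (x : ι → AdeleRing (𝓞 K) K) : vecHeight K (x ∘ e) = vecHeight K x := by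
  unfold vecHeight
  simp_rw [vecArchNorm_comp_equiv K e, vecFinHeight_comp_equiv K e]

end Reindex

namespace UnitaryGroup

variable {F E : Type} [Field F] [NumberField F] [Field E] [NumberField E] [Algebra F E] {c : E ≃ₐ[F] E} {N : ℕ} [NeZero N]

/-! ## §2 The first column of `g⁻¹` and its pairing with last rows -/

omit [NumberField F] in
/-- `rev 0 = ⊤` in `Fin N` (index plumbing). [folklore] -/
private theorem rev_zero_eq_top : Fin.rev (0 : Fin N) = ⊤ := by
  apply Fin.eq_of_val_eq
  rw [Fin.val_rev, Fin.val_zero]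
  obtain ⟨n, rfl⟩ := Nat.exists_eq_succ_of_ne_zero (NeZero.ne N)
  rfl

/-- **The first column of `g⁻¹` is the conjugate of the reversed last row of `g`**: `(g⁻¹)_{k,1} = c(g_{N, rev k})` for `g ∈ U(J_N)(𝔸_F)`
(★ `coe_inv_apply_of_mem_unitaryGroupOfForm_antidiagonal`). [cite: Rogawski1990, §1.9 p. 13] -/
theorem coe_inv_apply_zero_eq_smul_lastRow_rev (g : (quasiSplit F E c N).Adelic) (k : Fin N) :
    (((adelicVal F E c N _ g)⁻¹ : GL (Fin N) (AdeleRing (𝓞 E) E)) : Matrix (Fin N) (Fin N) (AdeleRing (𝓞 E) E)) k 0 =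
      c • lastRow g (Fin.rev k) := by
  rw [coe_inv_apply_of_mem_unitaryGroupOfForm_antidiagonal (conjAdele F E c) N (adelicVal_mem_unitaryGroupOfForm g) k 0,
    rev_zero_eq_top, conjAdele_apply, lastRow_apply]

/-- As a vector: the first column of `g⁻¹` is `c • (lastRow g ∘ rev)`. [cite: Rogawski1990, §1.9 p. 13] -/
theorem inv_col_zero_eq_smul_lastRow_comp_rev (g : (quasiSplit F E c N).Adelic) :
    (fun k => (((adelicVal F E c N _ g)⁻¹ : GL (Fin N) (AdeleRing (𝓞 E) E)) : Matrix (Fin N) (Fin N) (AdeleRing (𝓞 E) E)) k 0) =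
      c • (lastRow g ∘ Fin.revPerm) := by
  funext k
  rw [coe_inv_apply_zero_eq_smul_lastRow_rev]
  rfl

/-- **`h(first column of g⁻¹) = h(e_N g)`** (Galois invariance ★ `vecHeight_galSmul` + reindexing). [cite: Godement1964, §1.1] -/
theorem vecHeight_inv_col_zero (g : (quasiSplit F E c N).Adelic) :
    vecHeight E (fun k => (((adelicVal F E c N _ g)⁻¹ : GL (Fin N) (AdeleRing (𝓞 E) E)) : Matrix (Fin N) (Fin N) (AdeleRing (𝓞 E) E)) k 0) =
      vecHeight E (lastRow g) := by
  rw [inv_col_zero_eq_smul_lastRow_comp_rev, vecHeight_galSmul, vecHeight_comp_equiv]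

/-- The first column of `g⁻¹` has finite height data. [cite: Garrett2018, §2.2 (PDF p. 82)] -/
theorem isHeightFinite_inv_col_zero (g : (quasiSplit F E c N).Adelic) :
    IsHeightFinite E (fun k => (((adelicVal F E c N _ g)⁻¹ : GL (Fin N) (AdeleRing (𝓞 E) E)) :
      Matrix (Fin N) (Fin N) (AdeleRing (𝓞 E) E)) k 0) := by
  rw [inv_col_zero_eq_smul_lastRow_comp_rev, isHeightFinite_galSmul_iff, isHeightFinite_comp_equiv_iff]
  exact isHeightFinite_lastRow g

/-- `e_N x · (j-th column of g⁻¹) = (x g⁻¹)_{N,j}`. [cite: Garrett2018, §2.2 (PDF p. 83)] -/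
theorem lastRow_dotProduct_inv_col (x g : (quasiSplit F E c N).Adelic) (j : Fin N) :
    lastRow x ⬝ᵥ (fun k => (((adelicVal F E c N _ g)⁻¹ : GL (Fin N) (AdeleRing (𝓞 E) E)) : Matrix (Fin N) (Fin N) (AdeleRing (𝓞 E) E)) k j) =
      (adelicVal F E c N _ (x * g⁻¹) : Matrix (Fin N) (Fin N) (AdeleRing (𝓞 E) E)) ⊤ j := by
  rw [map_mul, map_inv, Units.val_mul, Matrix.mul_apply]
  rfl

/-- **`e_N (γ g) · (first column of g⁻¹) = γ_{N,1}`** (the bottom-left entry of the RATIONAL `γ`, diagonally embedded).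
[cite: Garrett2018, §2.2 (PDF p. 83)] -/
theorem lastRow_toAdelic_mul_dotProduct_inv_col_zero (γ : (quasiSplit F E c N).Rational) (g : (quasiSplit F E c N).Adelic) :
    lastRow ((quasiSplit F E c N).toAdelic γ * g) ⬝ᵥ
        (fun k => (((adelicVal F E c N _ g)⁻¹ : GL (Fin N) (AdeleRing (𝓞 E) E)) : Matrix (Fin N) (Fin N) (AdeleRing (𝓞 E) E)) k 0) =
      algebraMap E (AdeleRing (𝓞 E) E) (((γ.1 : GL (Fin N) E) : Matrix (Fin N) (Fin N) E) ⊤ 0) := by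
  rw [lastRow_dotProduct_inv_col, mul_inv_cancel_right]
  rfl

/-! ## §3 `H(γ g) · H(g) ≤ 1` on the big cell -/

/-- **`1 ≤ h(e_N γ g) · h(e_N g)`** for `γ ∈ U(J_N)(F)` with `γ_{N,1} ≠ 0` and any `g ∈ U(J_N)(𝔸_F)`: Godement's inequality `|x · y|_𝔸 ≤ h(x) h(y)`
(★ `ideleNorm_le_vecHeight_mul_vecHeight`) for `x = e_N γ g`, `y` = first column of `g⁻¹`, whose product `γ_{N,1}` is a principal idèle of norm `1`
(★ `ideleNorm_principal`). [cite: Godement1964, §1.1] -/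
theorem one_le_vecHeight_lastRow_mul (γ : (quasiSplit F E c N).Rational)
    (hγ : ((γ.1 : GL (Fin N) E) : Matrix (Fin N) (Fin N) E) ⊤ 0 ≠ 0) (g : (quasiSplit F E c N).Adelic) :
    1 ≤ vecHeight E (lastRow ((quasiSplit F E c N).toAdelic γ * g)) * vecHeight E (lastRow g) := by
  set a : Eˣ := Units.mk0 _ hγ with ha
  have hnorm : IdeleClassGroup.ideleNorm E (Units.map (algebraMap E (AdeleRing (𝓞 E) E) : E →* AdeleRing (𝓞 E) E) a) = 1 :=
    ideleNorm_principal ⟨a, rfl⟩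
  rw [← hnorm, ← vecHeight_inv_col_zero g]
  exact ideleNorm_le_vecHeight_mul_vecHeight (isHeightFinite_lastRow _) (isHeightFinite_inv_col_zero g) _
    (by rw [Units.coe_map, lastRow_toAdelic_mul_dotProduct_inv_col_zero]; rfl)

/-- **THE HEIGHT DROP OFF THE BOREL: `H(γ g) · H(g) ≤ 1`** for every rational `γ ∈ U(J_N)(F)` in the big cell (`γ_{N,1} ≠ 0`) and every
`g ∈ U(J_N)(𝔸_F)` — the `U(J_N)` analogue of `Im(γz) Im(z) ≤ 1` (`SL₂(ℤ)`, `c ≠ 0`); constant ONE, no Siegel set needed.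
[cite: Garrett2018, §1.5 and §2.3] [cite: Rogawski1990, §2.2 p. 13] -/
theorem borelHeight_toAdelic_mul_mul_borelHeight_le_one (γ : (quasiSplit F E c N).Rational)
    (hγ : ((γ.1 : GL (Fin N) E) : Matrix (Fin N) (Fin N) E) ⊤ 0 ≠ 0) (g : (quasiSplit F E c N).Adelic) :
    borelHeight ((quasiSplit F E c N).toAdelic γ * g) * borelHeight g ≤ 1 := by
  rw [borelHeight_def, borelHeight_def, ← mul_inv]
  exact inv_le_one_of_one_le₀ (one_le_vecHeight_lastRow_mul γ hγ g)

/-- Equivalently `H(γ g) ≤ H(g)⁻¹`. [cite: Garrett2018, §1.5 and §2.3] -/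
theorem borelHeight_toAdelic_mul_le_inv (γ : (quasiSplit F E c N).Rational)
    (hγ : ((γ.1 : GL (Fin N) E) : Matrix (Fin N) (Fin N) E) ⊤ 0 ≠ 0) (g : (quasiSplit F E c N).Adelic)
    (hg : borelHeight g ≠ 0) :
    borelHeight ((quasiSplit F E c N).toAdelic γ * g) ≤ (borelHeight g)⁻¹ := by
  rw [NNReal.le_inv_iff_mul_le hg]
  exact borelHeight_toAdelic_mul_mul_borelHeight_le_one γ hγ g

/-- **At most one of `g`, `γ g` is high in the cusp**: if `H(g) > 1` then `H(γ g) < 1` for `γ` in the big cell. [cite: Garrett2018, §2.3] -/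
theorem borelHeight_toAdelic_mul_lt_one (γ : (quasiSplit F E c N).Rational)
    (hγ : ((γ.1 : GL (Fin N) E) : Matrix (Fin N) (Fin N) E) ⊤ 0 ≠ 0) {g : (quasiSplit F E c N).Adelic} (hg : 1 < borelHeight g) :
    borelHeight ((quasiSplit F E c N).toAdelic γ * g) < 1 := by
  by_contra h
  rw [not_lt] at h
  have h1 := borelHeight_toAdelic_mul_mul_borelHeight_le_one γ hγ g
  have h2 : (1 : ℝ≥0) < borelHeight ((quasiSplit F E c N).toAdelic γ * g) * borelHeight g :=
    lt_of_lt_of_le (by rw [one_mul]; exact hg) (mul_le_mul' h le_rfl)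
  exact absurd h1 (not_le.mpr h2)

end UnitaryGroup

/-! ## §4 `N = 3`: off the Borel means in the big cell -/

namespace UnitaryGroup

variable {F E : Type} [Field F] [NumberField F] [Field E] [NumberField E] [Algebra F E] {c : E ≃ₐ[F] E}

/-- **For `U(J₃)`: `γ ∉ B` ⇒ `γ_{3,1} ≠ 0`.** The last row `v` of a unitary `γ` is isotropic for `J₃` — `v₁ c(v₃) + v₂ c(v₂) + v₃ c(v₁) =
(γ γ⁻¹)_{3,1} = 0` by ★ `coe_inv_apply_of_mem_unitaryGroupOfForm_antidiagonal` — so `v₁ = 0` forces `v₂ = 0`, and then `γ` is upper triangular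
(★ `mem_borelAdelic_toAdelic_of_lastRow_eq_smul`): the Bruhat decomposition `G = B ⊔ B w B` of the rank-one group read on last rows.
[cite: Rogawski1990, §1.10] -/
theorem apply_top_zero_ne_zero_of_not_mem_borelAdelic {γ : (quasiSplit F E c 3).Rational}
    (hγ : (quasiSplit F E c 3).toAdelic γ ∉ borelAdelic F E c 3) :
    ((γ.1 : GL (Fin 3) E) : Matrix (Fin 3) (Fin 3) E) ⊤ 0 ≠ 0 := by
  intro h0
  apply hγ
  set A : Matrix (Fin 3) (Fin 3) E := ((γ.1 : GL (Fin 3) E) : Matrix (Fin 3) (Fin 3) E) with hA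
  have htop : (⊤ : Fin 3) = 2 := rfl
  have h20 : A 2 0 = 0 := by rw [← htop]; exact h0
  -- isotropy of the last row: `Σ_k A 2 k · (γ⁻¹) k 0 = (A A⁻¹) 2 0 = 0` with `(γ⁻¹) k 0 = c (A 2 (rev k))`
  have hinv : ∀ i j : Fin 3, (((γ.1 : GL (Fin 3) E)⁻¹ : GL (Fin 3) E) : Matrix (Fin 3) (Fin 3) E) i j =
      (c : E →+* E) (A (Fin.rev j) (Fin.rev i)) := fun i j =>
    coe_inv_apply_of_mem_unitaryGroupOfForm_antidiagonal (c : E →+* E) 3 γ.2 i j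
  have hmul : A * (((γ.1 : GL (Fin 3) E)⁻¹ : GL (Fin 3) E) : Matrix (Fin 3) (Fin 3) E) = 1 := by
    rw [hA, ← Units.val_mul, mul_inv_cancel, Units.val_one]
  have h21 : A 2 1 = 0 := by
    have h := congrFun (congrFun hmul 2) 0
    rw [Matrix.mul_apply, Fin.sum_univ_three, hinv, hinv, hinv, Matrix.one_apply_ne (by decide)] at h
    change A 2 0 * (c : E →+* E) (A 2 2) + A 2 1 * (c : E →+* E) (A 2 1) + A 2 2 * (c : E →+* E) (A 2 0) = 0 at h
    rw [h20, zero_mul, map_zero, mul_zero, zero_add, add_zero] at h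
    rcases mul_eq_zero.mp h with h1 | h1
    · exact h1
    · exact (map_eq_zero_iff (c : E →+* E) (c : E ≃ₐ[F] E).injective).mp h1
  refine mem_borelAdelic_toAdelic_of_lastRow_eq_smul (a := A 2 2) (funext fun j => ?_)
  rw [htop]
  fin_cases j
  · simp [← hA, h20]
  · simp [← hA, h21]
  · simp [← hA]

/-- **`H(γ g) · H(g) ≤ 1` for every `γ ∈ U(J₃)(F) ∖ B(F)` and every `g ∈ U(J₃)(𝔸_F)`** (rational points as ★ `quasiSplit.Rational`, `B(𝔸_F)` =
★ `borelAdelic`). [cite: Garrett2018, §1.5 and §2.3] [cite: Rogawski1990, §2.2 p. 13] -/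
theorem borelHeight_mul_borelHeight_le_one_of_not_mem_borelAdelic {γ : (quasiSplit F E c 3).Rational}
    (hγ : (quasiSplit F E c 3).toAdelic γ ∉ borelAdelic F E c 3) (g : (quasiSplit F E c 3).Adelic) :
    borelHeight ((quasiSplit F E c 3).toAdelic γ * g) * borelHeight g ≤ 1 :=
  borelHeight_toAdelic_mul_mul_borelHeight_le_one γ (apply_top_zero_ne_zero_of_not_mem_borelAdelic hγ) g

/-- The same for `γ` in the arithmetic subgroup `G(F) ≤ G(𝔸_F)` off ★ `arithmeticBorel` (the currency of ★ `pseudoEisenstein` ∕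
★ `truncatedKernel`): **`H(γ g) · H(g) ≤ 1`**. [cite: Garrett2018, §1.5 and §2.3] [cite: Rogawski1990, §2.2 p. 13] -/
theorem borelHeight_mul_borelHeight_le_one_of_not_mem_arithmeticBorel {γ : (quasiSplit F E c 3).arithmeticSubgroup}
    (hγ : γ ∉ arithmeticBorel F E c 3) (g : (quasiSplit F E c 3).Adelic) :
    borelHeight ((γ : (quasiSplit F E c 3).Adelic) * g) * borelHeight g ≤ 1 := by
  obtain ⟨γ₀, hγ₀⟩ := MonoidHom.mem_range.mp γ.2
  rw [← hγ₀]
  refine borelHeight_mul_borelHeight_le_one_of_not_mem_borelAdelic (fun h => hγ ?_) g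
  rw [mem_arithmeticBorel_iff, ← hγ₀]
  exact h

/-- **At most one of `g`, `γ g` is high in the cusp** (`U(J₃)`, `γ ∈ G(F) ∖ B(F)`): `H(g) > 1 ⇒ H(γ g) < 1`. [cite: Garrett2018, §2.3] -/
theorem borelHeight_mul_lt_one_of_not_mem_arithmeticBorel {γ : (quasiSplit F E c 3).arithmeticSubgroup}
    (hγ : γ ∉ arithmeticBorel F E c 3) {g : (quasiSplit F E c 3).Adelic} (hg : 1 < borelHeight g) :
    borelHeight ((γ : (quasiSplit F E c 3).Adelic) * g) < 1 := by
  obtain ⟨γ₀, hγ₀⟩ := MonoidHom.mem_range.mp γ.2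
  rw [← hγ₀]
  refine borelHeight_toAdelic_mul_lt_one γ₀ (apply_top_zero_ne_zero_of_not_mem_borelAdelic fun h => hγ ?_) hg
  rw [mem_arithmeticBorel_iff, ← hγ₀]
  exact h

end UnitaryGroup

end Literature.NumberTheory.Automorphic
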